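import Mathlib
import Summits.CriticalPhenomena.CardyFormulaZ2.Theorems.CardyMagicRigidityMagicFormulaTExistsLimitA2Comparison
import Summits.CriticalPhenomena.CardyFormulaZ2.Theorems.CardyMagicRigidityMagicFormulaTExistsLimitA2Truncation
import Summits.CriticalPhenomena.CardyFormulaZ2.Theorems.CardyMagicRigidityMagicFormulaTAprioriBounds
import Summits.CriticalPhenomena.CardyFormulaZ2.Theorems.CardyMagicRigidityMagicFormulaTRibbonRarity
import Summits.CriticalPhenomena.CardyFormulaZ2.Theorems.CardyMagicRigidityMagicFormulaTExistsLimitCoupling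
import Literature.Probability.Percolation.FullPlaneCNL
import Literature.Probability.Percolation.TriCorrLengthExponentDecomposition
import HarnessLib

/-!
# Existence of `lim_{δ→0⁺} E_{1/2}[A₂]`, `A₂ = Σ_u θ_u²`, modulo Camia–Newman + Smirnov–Werner
(crux `MagicFormulaT`, line `Sketch` v10, sub-goal `el_existsLimitA2_of_facts`) — part 3/3

Crux `Summit.CriticalPhenomena.CardyFormulaZ2.Theses.CardyMagicRigidity.MagicFormulaT`
(stmt-CriticalPhenomena-4836), line `Sketch`, skeleton v10, registered sub-goal `el_existsLimitA2_of_facts`: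
for every admissible density `f` (measurable, `|f| ≤ C`, `f = 0` off `B̄(0,R)`, `∫ f = 0`) the expectation of the
squared-phase power sum `A₂ = Σ_u θ_u²` (`θ_u = u.nestingPhase f`, loops of `siteLoopConfig δ ω` under
`triSitePercolation half`) has a limit as `δ → 0⁺`, CONDITIONALLY on the two named facts
`exists_isFullPlaneCNLLaw` (Camia–Newman, CMP 268 (2006), Cauchy form
`exists_isFullPlaneCNLLaw.cnLawEDist_siteLoopConfig_le`) and `SmirnovWerner2001_fourArm_scalingLimit`
(through the ribbon bound `stub_ribbonRarity`), both HYPOTHESES of the theorem.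

Proof: the Cauchy argument of c3's `stub_existsLimit` (product weights) run for the truncated squared-phase
sums `S_t = Σ_{diam ≥ t} θ_u²`.  Fix `κ > 0`, `κ₁ = κ/10`.  (UV, `ela2_truncation`) `|E[A₂] − E[S_t]| ≤ K_UV t²`
for `0 < δ ≤ t ≤ 1`; choose `η ≤ 1` with `K_UV η² ≤ κ₁` and average over the `m` thresholds
`η_j = η/2 + (j+1)η/(2m) ∈ (η/2, η]`: `|E[A₂] − E[S̄]| ≤ κ₁`.  (A) `0 ≤ S̄ ≤ A₂` and `E[A₂²] ≤ B` uniformly in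
small `δ` (`ela2_sqMoment`); `p₀ = κ₁²/(2(4B+1))`; the count/window/sausage bounds of `stub_aprioriBounds` and
the ribbon bound `stub_ribbonRarity` each with probability `≤ p₀/10`.  (B) On the good event the deterministic
comparison `ela2_closeComparison` bounds `|S̄_δ − S̄_{δ'}| ≤ N₀(2KCτ + 4π²C²η⁴/m) ≤ κ₁` (`τ`, then `m`, chosen
accordingly).  For two meshes couple the configurations by `Q` with marginals `P` (CN,
`exists_coupling_of_cnLawEDist_lt` at scale `ε/2`) and apply the abstract coupling estimate
`el_coupling_estimate`: `|E S̄_δ − E S̄_{δ'}| ≤ 2κ₁`.  Total `≤ 4κ₁ < κ`; conclude by `el_exists_tendsto_of_cauchy`.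
-/

noncomputable section

namespace Summit.CriticalPhenomena.CardyFormulaZ2.Cruxes.MagicFormulaT.LineSketch

open MeasureTheory Filter Set
open scoped Real Topology BigOperators ENNReal
open Literature.Probability.RandomPlanarGeometry Literature.Probability.Percolation
  Literature.Probability.LatticeModels

/-! ## The registered sub-goal -/

/-- **Sub-goal EL-A2 (`el_existsLimitA2_of_facts`, registered, verbatim signature): modulo Camia–Newman and
Smirnov–Werner, `lim_{δ→0⁺} E_{1/2}[A₂]` exists for every admissible `f`** — see the module docstring. -/
theorem el_existsLimitA2_of_facts : exists_isFullPlaneCNLLaw → SmirnovWerner2001_fourArm_scalingLimit →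
    ∀ (f : ℂ → ℝ) (R C : ℝ), Measurable f → (∀ z, |f z| ≤ C) → (∀ z, R < ‖z‖ → f z = 0) → ∫ z, f z = 0 →
    ∃ L : ℝ, Tendsto (fun δ : ℝ ↦ ∫ ω, (∑ᶠ u ∈ (siteLoopConfig δ ω).loops, u.nestingPhase f ^ 2)
      ∂(triSitePercolation half)) (𝓝[>] (0 : ℝ)) (𝓝 L) := by
  intro hCN hSW f R C hf hC hR h0
  obtain ⟨-, hA2, hA3, hA4⟩ := stub_aprioriBounds
  have hRib := stub_ribbonRarity hSW
  obtain ⟨KUV, hKUV, hUV⟩ := ela2_truncation f R C hf hC hR h0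
  obtain ⟨B, δM, hB, hδM, hsqM⟩ := ela2_sqMoment f R C hf hC hR h0
  set P : Measure (SiteConfig (Site 2)) := triSitePercolation half with hPdef
  apply el_exists_tendsto_of_cauchy
  intro κ hκ
  set κ₁ : ℝ := κ / 10 with hκ₁def
  have hκ₁ : 0 < κ₁ := by positivity
  have hC0 : 0 ≤ C := nonneg_of_abs_le hC
  -- the cut-off `η ≤ 1` with `K_UV η² ≤ κ₁`
  set η : ℝ := min 1 (κ₁ / (KUV + 1)) with hηdef
  have hη : 0 < η := by positivity
  have hη1 : η ≤ 1 := min_le_left _ _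
  have hηK : η ≤ κ₁ / (KUV + 1) := min_le_right _ _
  have hUVη : KUV * η ^ 2 ≤ κ₁ := by
    have h1 : KUV * η ^ 2 ≤ KUV * η := by
      have : η ^ 2 ≤ η := by nlinarith
      exact mul_le_mul_of_nonneg_left this hKUV
    have h2 : KUV * η ≤ KUV * (κ₁ / (KUV + 1)) := mul_le_mul_of_nonneg_left hηK hKUV
    have h3 : KUV * (κ₁ / (KUV + 1)) ≤ κ₁ := by
      rw [show KUV * (κ₁ / (KUV + 1)) = κ₁ * (KUV / (KUV + 1)) by ring]
      calc κ₁ * (KUV / (KUV + 1)) ≤ κ₁ * 1 := by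
            gcongr
            exact (div_le_one (by positivity)).2 (by linarith)
        _ = κ₁ := mul_one _
    linarith
  set p₀ : ℝ := κ₁ ^ 2 / (2 * (4 * B + 1)) with hp₀def
  have hp₀ : 0 < p₀ := by positivity
  -- (A)(ii): tightness of the number of relevant loops
  obtain ⟨N₀, δN, hδN, hN⟩ := hA2 (R + 1) (η / 5) (p₀ / 10) (by positivity) (by positivity)
  -- the comparison constants, the number of thresholds `m` and the sausage tolerance `τ`
  set Kc : ℝ := 2 * (C * volume.real (Metric.closedBall (0 : ℂ) R)) * C with hKcdef
  have hKc0 : 0 ≤ Kc := mul_nonneg (mul_nonneg zero_le_two (mul_nonneg hC0 measureReal_nonneg)) hC0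
  set Dc : ℝ := 4 * π ^ 2 * C ^ 2 * η ^ 4 with hDcdef
  have hDc0 : 0 ≤ Dc := by positivity
  set m : ℕ := ⌈2 * (N₀ * Dc) / κ₁⌉₊ + 1 with hmdef
  have hm1 : 1 ≤ m := Nat.le_add_left 1 _
  have hmpos : (0 : ℝ) < m := by exact_mod_cast hm1
  have hmK : N₀ * (Dc / m) ≤ κ₁ / 2 := by
    have h1 : 2 * (N₀ * Dc) / κ₁ ≤ m := by
      rw [hmdef]; push_cast
      exact (Nat.le_ceil _).trans (le_add_of_nonneg_right zero_le_one)
    have h2 : 2 * (N₀ * Dc) ≤ κ₁ * m := by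
      have := (div_le_iff₀ hκ₁).1 h1
      linarith
    have h3 : (N₀ : ℝ) * (Dc / m) = N₀ * Dc / m := by ring
    rw [h3, div_le_iff₀ hmpos]
    linarith
  set τ : ℝ := κ₁ / 2 / (N₀ * Kc + 1) with hτdef
  have hτ : 0 < τ := by positivity
  have hτK : N₀ * (Kc * τ) ≤ κ₁ / 2 := by
    have hx : 0 ≤ (N₀ : ℝ) * Kc := by positivity
    have h1 : (N₀ : ℝ) * Kc / (N₀ * Kc + 1) ≤ 1 := (div_le_one (by positivity)).2 (by linarith)
    have h2 : (N₀ : ℝ) * (Kc * τ) = κ₁ / 2 * (N₀ * Kc / (N₀ * Kc + 1)) := by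
      rw [hτdef]; ring
    rw [h2]
    calc κ₁ / 2 * (N₀ * Kc / (N₀ * Kc + 1)) ≤ κ₁ / 2 * 1 := by gcongr
      _ = κ₁ / 2 := mul_one _
  have hcmpBound : N₀ * (2 * (C * volume.real (Metric.closedBall (0 : ℂ) R)) * C * τ +
      4 * π ^ 2 * C ^ 2 * η ^ 4 / m) ≤ κ₁ := by
    have : (N₀ : ℝ) * (2 * (C * volume.real (Metric.closedBall (0 : ℂ) R)) * C * τ +
        4 * π ^ 2 * C ^ 2 * η ^ 4 / m) = N₀ * (Kc * τ) + N₀ * (Dc / m) := by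
      rw [hKcdef, hDcdef]; ring
    rw [this]; linarith
  obtain ⟨εS, hεS, hS⟩ := hA4 R (η / 5) τ (p₀ / 10) (by positivity) hτ (by positivity)
  obtain ⟨εR, hεR, hRb⟩ := hRib (R + 1) (η / 5) (p₀ / 10) (by positivity) (by positivity)
  obtain ⟨D, δW, hD, hδW, hW⟩ := hA3 (R + 1) (p₀ / 10) (by positivity)
  -- the closeness scale `ε`
  set ε : ℝ := min (min (min εS εR) (min (1 / D) (η / (8 * m)))) (min 1 (p₀ / 10)) with hεdef
  have hε : 0 < ε := by positivity
  have hεS' : ε ≤ εS := by rw [hεdef]; exact (min_le_left _ _).trans ((min_le_left _ _).trans (min_le_left _ _))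
  have hεR' : ε ≤ εR := by rw [hεdef]; exact (min_le_left _ _).trans ((min_le_left _ _).trans (min_le_right _ _))
  have hεD : ε ≤ 1 / D := by rw [hεdef]; exact (min_le_left _ _).trans ((min_le_right _ _).trans (min_le_left _ _))
  have hεm : ε ≤ η / (8 * m) := by
    rw [hεdef]; exact (min_le_left _ _).trans ((min_le_right _ _).trans (min_le_right _ _))
  have hε1 : ε ≤ 1 := by rw [hεdef]; exact (min_le_right _ _).trans (min_le_left _ _)
  have hεp : ε ≤ p₀ / 10 := by rw [hεdef]; exact (min_le_right _ _).trans (min_le_right _ _)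
  have h8m : 8 * m * ε ≤ η := by
    have := mul_le_mul_of_nonneg_left hεm (by positivity : (0 : ℝ) ≤ 8 * m)
    calc 8 * m * ε ≤ 8 * m * (η / (8 * m)) := this
      _ = η := by field_simp
  obtain ⟨δS, hδS, hS'⟩ := hS ε hε hεS'
  obtain ⟨δR, hδR, hR'⟩ := hRb ε hε hεR'
  -- (CN): couplings at scale `ε/2`
  have hCNev := hCN.cnLawEDist_siteLoopConfig_le (η := ENNReal.ofReal (ε / 2))
    (ENNReal.ofReal_pos.2 (half_pos hε))
  rw [Filter.eventually_prod_iff] at hCNev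
  obtain ⟨pa, hpa, pb, hpb, hprod⟩ := hCNev
  obtain ⟨δa, hδa, ha⟩ := el_exists_Ioo_of_eventually hpa
  obtain ⟨δb, hδb, hb⟩ := el_exists_Ioo_of_eventually hpb
  -- the `m` thresholds
  set thr : ℕ → ℝ := fun j ↦ η / 2 + ((j : ℝ) + 1) * η / (2 * m) with hthrdef
  have hthr_le : ∀ j ∈ Finset.range m, thr j ≤ η := fun j hj ↦ cc_threshold_le hη.le hj
  have hthr_ge : ∀ j : ℕ, η / 2 ≤ thr j := by
    intro j; simp only [hthrdef]
    have : 0 ≤ ((j : ℝ) + 1) * η / (2 * m) := by positivity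
    linarith
  have hthr_UV : ∀ j ∈ Finset.range m, KUV * thr j ^ 2 ≤ κ₁ := by
    intro j hj
    have h0j : 0 ≤ thr j := (half_pos hη).le.trans (hthr_ge j)
    calc KUV * thr j ^ 2 ≤ KUV * η ^ 2 :=
          mul_le_mul_of_nonneg_left (pow_le_pow_left₀ h0j (hthr_le j hj) 2) hKUV
      _ ≤ κ₁ := hUVη
  refine ⟨min (min (min δM δN) (min δS δR)) (min (min δW (η / 2)) (min δa δb)), by positivity, ?_⟩
  intro δ δ' hδ hδlt hδ' hδ'lt
  -- unpack the mesh bounds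
  have hlt : ∀ {x : ℝ}, x < min (min (min δM δN) (min δS δR)) (min (min δW (η / 2)) (min δa δb)) →
      x < δM ∧ x < δN ∧ x < δS ∧ x < δR ∧ x < δW ∧ x < η / 2 ∧ x < δa ∧ x < δb := by
    intro x hx
    simp only [lt_min_iff] at hx
    exact ⟨hx.1.1.1, hx.1.1.2, hx.1.2.1, hx.1.2.2, hx.2.1.1, hx.2.1.2, hx.2.2.1, hx.2.2.2⟩
  obtain ⟨h1M, h1N, h1S, h1R, h1W, h1U, h1a, _⟩ := hlt hδlt
  obtain ⟨h2M, h2N, _, h2R, h2W, h2U, _, h2b⟩ := hlt hδ'lt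
  -- the power sum and the averaged truncated sums
  set A2 : ℝ → SiteConfig (Site 2) → ℝ := fun d ω ↦
    ∑ᶠ u ∈ (siteLoopConfig d ω).loops, u.nestingPhase f ^ 2 with hA2def
  set Abar : ℝ → SiteConfig (Site 2) → ℝ := fun d ω ↦
    (∑ j ∈ Finset.range m, ∑ᶠ u ∈ (siteLoopConfig d ω).bigLoops (η / 2 + ((j : ℝ) + 1) * η / (2 * m)),
      u.nestingPhase f ^ 2) / m with hAbardef
  -- properties of `Abar d` for `d ∈ {δ, δ'}`
  have hAprops : ∀ d : ℝ, 0 < d → d < δM → d < η / 2 →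
      Measurable (Abar d) ∧ Integrable (Abar d) P ∧ Integrable (fun ω ↦ Abar d ω ^ 2) P ∧
        ∫ ω, Abar d ω ^ 2 ∂P ≤ B ∧ |(∫ ω, A2 d ω ∂P) - ∫ ω, Abar d ω ∂P| ≤ κ₁ := by
    intro d hd hdM hdη
    obtain ⟨hIA, hIA2, hEB⟩ := hsqM d hd hdM
    have hT : ∀ j ∈ Finset.range m,
        (Measurable fun ω ↦ ∑ᶠ u ∈ (siteLoopConfig d ω).bigLoops (thr j), u.nestingPhase f ^ 2) ∧
        Integrable (fun ω ↦ ∑ᶠ u ∈ (siteLoopConfig d ω).bigLoops (thr j), u.nestingPhase f ^ 2) P ∧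
        (∀ ω, 0 ≤ ∑ᶠ u ∈ (siteLoopConfig d ω).bigLoops (thr j), u.nestingPhase f ^ 2 ∧
          ∑ᶠ u ∈ (siteLoopConfig d ω).bigLoops (thr j), u.nestingPhase f ^ 2 ≤ A2 d ω) ∧
        |(∫ ω, A2 d ω ∂P) - ∫ ω, (∑ᶠ u ∈ (siteLoopConfig d ω).bigLoops (thr j), u.nestingPhase f ^ 2) ∂P| ≤
          KUV * thr j ^ 2 := fun j hj ↦
      hUV (thr j) d hd (hdη.le.trans (hthr_ge j)) ((hthr_le j hj).trans hη1)
    have hM : Measurable (Abar d) := by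
      simp only [hAbardef]
      exact (Finset.measurable_sum _ fun j hj ↦ (hT j hj).1).div_const _
    have hI : Integrable (Abar d) P := by
      simp only [hAbardef]
      exact (integrable_finsetSum _ fun j hj ↦ (hT j hj).2.1).div_const _
    have hbounds : ∀ ω, 0 ≤ Abar d ω ∧ Abar d ω ≤ A2 d ω := by
      intro ω
      simp only [hAbardef]
      constructor
      · exact div_nonneg (Finset.sum_nonneg fun j hj ↦ ((hT j hj).2.2.1 ω).1) hmpos.le
      · rw [div_le_iff₀ hmpos]
        calc ∑ j ∈ Finset.range m, ∑ᶠ u ∈ (siteLoopConfig d ω).bigLoops (thr j), u.nestingPhase f ^ 2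
            ≤ ∑ _j ∈ Finset.range m, A2 d ω := Finset.sum_le_sum fun j hj ↦ ((hT j hj).2.2.1 ω).2
          _ = A2 d ω * m := by rw [Finset.sum_const, Finset.card_range, nsmul_eq_mul, mul_comm]
    have hdom : ∀ ω, Abar d ω ^ 2 ≤ A2 d ω ^ 2 := fun ω ↦
      pow_le_pow_left₀ (hbounds ω).1 (hbounds ω).2 2
    have hI2 : Integrable (fun ω ↦ Abar d ω ^ 2) P := by
      refine hIA2.mono' (hM.pow_const 2).aestronglyMeasurable (Eventually.of_forall fun ω ↦ ?_)
      rw [Real.norm_eq_abs, abs_of_nonneg (sq_nonneg _)]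
      exact hdom ω
    have hEB' : ∫ ω, Abar d ω ^ 2 ∂P ≤ B := (integral_mono hI2 hIA2 hdom).trans hEB
    have hEavg : ∫ ω, Abar d ω ∂P =
        (∑ j ∈ Finset.range m, ∫ ω, (∑ᶠ u ∈ (siteLoopConfig d ω).bigLoops (thr j), u.nestingPhase f ^ 2) ∂P)
          / m := by
      simp only [hAbardef]
      rw [integral_div, integral_finsetSum _ fun j hj ↦ (hT j hj).2.1]
    have hUVd : |(∫ ω, A2 d ω ∂P) - ∫ ω, Abar d ω ∂P| ≤ κ₁ := by
      rw [hEavg]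
      exact el_abs_sub_avg_le hm1
        (a := fun j ↦ ∫ ω, (∑ᶠ u ∈ (siteLoopConfig d ω).bigLoops (thr j), u.nestingPhase f ^ 2) ∂P)
        fun j hj ↦ ((hT j hj).2.2.2).trans (hthr_UV j hj)
    exact ⟨hM, hI, hI2, hEB', hUVd⟩
  obtain ⟨hM1, hI1, hI21, hEB1, hUV1⟩ := hAprops δ hδ h1M h1U
  obtain ⟨hM2, hI2, hI22, hEB2, hUV2⟩ := hAprops δ' hδ' h2M h2U
  -- the coupling
  have hdist : LoopConfig.cnLawEDist P (siteLoopConfig δ) P (siteLoopConfig δ') < ENNReal.ofReal ε := by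
    have h := hprod (ha δ hδ h1a) (hb δ' hδ' h2b)
    refine lt_of_le_of_lt h ?_
    exact (ENNReal.ofReal_lt_ofReal_iff hε).2 (by linarith)
  obtain ⟨Q, hQ1, hQ2, hQbad⟩ := LoopConfig.exists_coupling_of_cnLawEDist_lt hdist
  -- the bad sets
  set Sc : ℝ → Set (SiteConfig (Site 2)) := fun d ↦ {ω | ¬ ({u ∈ (siteLoopConfig d ω).loops |
      (u.range ∩ Metric.closedBall (0 : ℂ) (R + 1)).Nonempty ∧ η / 5 ≤ Metric.diam u.range}.Finite ∧
    {u ∈ (siteLoopConfig d ω).loops |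
      (u.range ∩ Metric.closedBall (0 : ℂ) (R + 1)).Nonempty ∧ η / 5 ≤ Metric.diam u.range}.ncard ≤ N₀)}
    with hScdef
  set Sw : ℝ → Set (SiteConfig (Site 2)) := fun d ↦ {ω | ∃ u ∈ (siteLoopConfig d ω).loops,
      (u.range ∩ Metric.closedBall (0 : ℂ) (R + 1)).Nonempty ∧ ¬ (u.range ⊆ Metric.ball (0 : ℂ) D)}
    with hSwdef
  set Ss : ℝ → Set (SiteConfig (Site 2)) := fun d ↦ {ω | ∃ u ∈ (siteLoopConfig d ω).loops,
      (u.range ∩ Metric.closedBall (0 : ℂ) (R + 1)).Nonempty ∧ η / 5 ≤ Metric.diam u.range ∧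
      τ < volume.real ({z : ℂ | Metric.infDist z u.range ≤ ε} ∩ Metric.closedBall (0 : ℂ) R)}
    with hSsdef
  set Sr : ℝ → Set (SiteConfig (Site 2)) := fun d ↦ {ω | ∃ u ∈ (siteLoopConfig d ω).loops,
      ∃ v ∈ (siteLoopConfig d ω).loops,
      u ≠ v ∧ (u.range ∩ Metric.closedBall (0 : ℂ) (R + 1)).Nonempty ∧ η / 5 ≤ Metric.diam u.range ∧
      η / 5 ≤ Metric.diam v.range ∧ u.udist v ≤ 2 * ε} with hSrdef
  have hPc : ∀ d, 0 < d → d < δN → P (Sc d) ≤ ENNReal.ofReal (p₀ / 10) := fun d hd hdN ↦ hN d hd hdN.le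
  have hPw : ∀ d, 0 < d → d < δW → P (Sw d) ≤ ENNReal.ofReal (p₀ / 10) := fun d hd hdW ↦ hW d hd hdW.le
  have hPs : P (Ss δ) ≤ ENNReal.ofReal (p₀ / 10) := hS' δ hδ h1S.le
  have hPr : ∀ d, 0 < d → d < δR → P (Sr d) ≤ ENNReal.ofReal (p₀ / 10) := fun d hd hdR ↦ hR' d hd hdR.le
  set Bad0 : Set (SiteConfig (Site 2) × SiteConfig (Site 2)) :=
    {p | ¬ LoopConfig.IsClose ε (siteLoopConfig δ p.1) (siteLoopConfig δ' p.2)} ∪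
      (Prod.fst ⁻¹' (Sc δ ∪ Sw δ ∪ Ss δ ∪ Sr δ) ∪ Prod.snd ⁻¹' (Sc δ' ∪ Sw δ' ∪ Sr δ')) with hBad0def
  have hBad : Q Bad0 ≤ ENNReal.ofReal (κ₁ ^ 2 / (2 * (4 * B + 1))) := by
    have hp10 : (0 : ℝ) ≤ p₀ / 10 := by positivity
    have e2 : ENNReal.ofReal (p₀ / 10) + ENNReal.ofReal (p₀ / 10) = ENNReal.ofReal (2 * (p₀ / 10)) := by
      rw [← ENNReal.ofReal_add hp10 hp10]; congr 1; ring
    have e3 : ENNReal.ofReal (2 * (p₀ / 10)) + ENNReal.ofReal (p₀ / 10) = ENNReal.ofReal (3 * (p₀ / 10)) := by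
      rw [← ENNReal.ofReal_add (by positivity) hp10]; congr 1; ring
    have e4 : ENNReal.ofReal (3 * (p₀ / 10)) + ENNReal.ofReal (p₀ / 10) = ENNReal.ofReal (4 * (p₀ / 10)) := by
      rw [← ENNReal.ofReal_add (by positivity) hp10]; congr 1; ring
    have hfst : Q (Prod.fst ⁻¹' (Sc δ ∪ Sw δ ∪ Ss δ ∪ Sr δ)) ≤ ENNReal.ofReal (4 * (p₀ / 10)) := by
      refine (Measure.le_map_apply measurable_fst.aemeasurable _).trans ?_
      rw [hQ1]
      have u1 : P (Sc δ ∪ Sw δ ∪ Ss δ ∪ Sr δ) ≤ P (Sc δ ∪ Sw δ ∪ Ss δ) + P (Sr δ) :=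
        measure_union_le (μ := P) (Sc δ ∪ Sw δ ∪ Ss δ) (Sr δ)
      have u2 : P (Sc δ ∪ Sw δ ∪ Ss δ) ≤ P (Sc δ ∪ Sw δ) + P (Ss δ) :=
        measure_union_le (μ := P) (Sc δ ∪ Sw δ) (Ss δ)
      have u3 : P (Sc δ ∪ Sw δ) ≤ P (Sc δ) + P (Sw δ) := measure_union_le (μ := P) (Sc δ) (Sw δ)
      have v1 := hPc δ hδ h1N
      have v2 := hPw δ hδ h1W
      have v4 := hPr δ hδ h1R
      calc P (Sc δ ∪ Sw δ ∪ Ss δ ∪ Sr δ)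
          ≤ ((ENNReal.ofReal (p₀ / 10) + ENNReal.ofReal (p₀ / 10)) + ENNReal.ofReal (p₀ / 10)) +
              ENNReal.ofReal (p₀ / 10) := by
            calc P (Sc δ ∪ Sw δ ∪ Ss δ ∪ Sr δ) ≤ P (Sc δ ∪ Sw δ ∪ Ss δ) + P (Sr δ) := u1
              _ ≤ (P (Sc δ ∪ Sw δ) + P (Ss δ)) + P (Sr δ) := add_le_add u2 le_rfl
              _ ≤ ((P (Sc δ) + P (Sw δ)) + P (Ss δ)) + P (Sr δ) := add_le_add (add_le_add u3 le_rfl) le_rfl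
              _ ≤ _ := add_le_add (add_le_add (add_le_add v1 v2) hPs) v4
        _ = ENNReal.ofReal (4 * (p₀ / 10)) := by rw [e2, e3, e4]
    have hsnd : Q (Prod.snd ⁻¹' (Sc δ' ∪ Sw δ' ∪ Sr δ')) ≤ ENNReal.ofReal (3 * (p₀ / 10)) := by
      refine (Measure.le_map_apply measurable_snd.aemeasurable _).trans ?_
      rw [hQ2]
      have u2 : P (Sc δ' ∪ Sw δ' ∪ Sr δ') ≤ P (Sc δ' ∪ Sw δ') + P (Sr δ') :=
        measure_union_le (μ := P) (Sc δ' ∪ Sw δ') (Sr δ')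
      have u3 : P (Sc δ' ∪ Sw δ') ≤ P (Sc δ') + P (Sw δ') := measure_union_le (μ := P) (Sc δ') (Sw δ')
      have v1 := hPc δ' hδ' h2N
      have v2 := hPw δ' hδ' h2W
      have v4 := hPr δ' hδ' h2R
      calc P (Sc δ' ∪ Sw δ' ∪ Sr δ')
          ≤ (ENNReal.ofReal (p₀ / 10) + ENNReal.ofReal (p₀ / 10)) + ENNReal.ofReal (p₀ / 10) := by
            calc P (Sc δ' ∪ Sw δ' ∪ Sr δ') ≤ P (Sc δ' ∪ Sw δ') + P (Sr δ') := u2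
              _ ≤ (P (Sc δ') + P (Sw δ')) + P (Sr δ') := add_le_add u3 le_rfl
              _ ≤ _ := add_le_add (add_le_add v1 v2) v4
        _ = ENNReal.ofReal (3 * (p₀ / 10)) := by rw [e2, e3]
    have htot : Q Bad0 ≤ ENNReal.ofReal ε + (ENNReal.ofReal (4 * (p₀ / 10)) + ENNReal.ofReal (3 * (p₀ / 10))) :=
      (measure_union_le _ _).trans (add_le_add hQbad.le ((measure_union_le _ _).trans (add_le_add hfst hsnd)))
    have e5 : ENNReal.ofReal ε + (ENNReal.ofReal (4 * (p₀ / 10)) + ENNReal.ofReal (3 * (p₀ / 10))) =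
        ENNReal.ofReal (ε + (4 * (p₀ / 10) + 3 * (p₀ / 10))) := by
      rw [← ENNReal.ofReal_add (by positivity) (by positivity), ← ENNReal.ofReal_add hε.le (by positivity)]
    rw [e5] at htot
    refine htot.trans (ENNReal.ofReal_le_ofReal ?_)
    rw [← hp₀def]; linarith
  -- on the good set the comparison applies
  have hgood : ∀ p, p ∉ Bad0 → |Abar δ p.1 - Abar δ' p.2| ≤ κ₁ := by
    intro p hp
    have hu : ∀ {α : Type} {s t : Set α} {x : α}, x ∉ s ∪ t → x ∉ s ∧ x ∉ t :=
      fun h ↦ ⟨fun hs ↦ h (Or.inl hs), fun ht ↦ h (Or.inr ht)⟩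
    rw [hBad0def] at hp
    obtain ⟨hclose, hrest⟩ := hu hp
    obtain ⟨hp1, hp2⟩ := hu hrest
    have hp1' : p.1 ∉ Sc δ ∪ Sw δ ∪ Ss δ ∪ Sr δ := hp1
    have hp2' : p.2 ∉ Sc δ' ∪ Sw δ' ∪ Sr δ' := hp2
    obtain ⟨h123, hr1⟩ := hu hp1'
    obtain ⟨h12, hs1⟩ := hu h123
    obtain ⟨hc1, hw1⟩ := hu h12
    obtain ⟨h12', hr2⟩ := hu hp2'
    obtain ⟨hc2, hw2⟩ := hu h12'
    have hclose' : LoopConfig.IsClose ε (siteLoopConfig δ p.1) (siteLoopConfig δ' p.2) := not_not.1 hclose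
    simp only [hScdef, Set.mem_setOf_eq, not_not] at hc1 hc2
    simp only [hSwdef, Set.mem_setOf_eq, not_exists, not_and, not_not] at hw1 hw2
    simp only [hSsdef, Set.mem_setOf_eq, not_exists, not_and, not_lt] at hs1
    simp only [hSrdef, Set.mem_setOf_eq, not_exists, not_and, not_le] at hr1 hr2
    have hballD : Metric.ball (0 : ℂ) D ⊆ Metric.ball 0 (1 / ε) := by
      refine Metric.ball_subset_ball ?_
      have := hεD
      rwa [le_one_div hε hD] at this
    have key := ela2_closeComparison f R C hf hC hR h0 (siteLoopConfig δ p.1) (siteLoopConfig δ' p.2) ε η τ m N₀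
      hε hε1 hη h8m hτ.le hclose' hc1 hc2
      (fun u hu hmeet _ ↦ (hw1 u hu hmeet).trans hballD)
      (fun u hu hmeet _ ↦ (hw2 u hu hmeet).trans hballD)
      (fun u hu v hv hmu _ hdu hdv huv ↦ hr1 u hu v hv huv hmu hdu hdv)
      (fun u hu v hv hmu _ hdu hdv huv ↦ hr2 u hu v hv huv hmu hdu hdv)
      (fun u hu hmeet hdu ↦ hs1 u hu hmeet hdu)
    exact key.trans hcmpBound
  -- the coupling estimate
  have hmid := el_coupling_estimate (P := P) (Q := Q) hM1 hM2 hI1 hI2 hI21 hI22 hEB1 hEB2 hB hκ₁ hQ1 hQ2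
    hBad hgood
  -- conclusion
  show |(∫ ω, A2 δ ω ∂P) - ∫ ω, A2 δ' ω ∂P| ≤ κ
  have htri : |(∫ ω, A2 δ ω ∂P) - ∫ ω, A2 δ' ω ∂P|
      ≤ |(∫ ω, A2 δ ω ∂P) - ∫ ω, Abar δ ω ∂P| +
        |∫ ω, Abar δ ω ∂P - ∫ ω, Abar δ' ω ∂P| +
        |∫ ω, Abar δ' ω ∂P - ∫ ω, A2 δ' ω ∂P| := by
    have key : (∫ ω, A2 δ ω ∂P) - ∫ ω, A2 δ' ω ∂P =
        ((∫ ω, A2 δ ω ∂P) - ∫ ω, Abar δ ω ∂P) +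
        (∫ ω, Abar δ ω ∂P - ∫ ω, Abar δ' ω ∂P) +
        (∫ ω, Abar δ' ω ∂P - ∫ ω, A2 δ' ω ∂P) := by ring
    rw [key]
    exact abs_add_three _ _ _
  rw [abs_sub_comm] at hUV2
  calc |(∫ ω, A2 δ ω ∂P) - ∫ ω, A2 δ' ω ∂P|
      ≤ κ₁ + 2 * κ₁ + κ₁ := htri.trans (add_le_add (add_le_add hUV1 hmid) hUV2)
    _ ≤ κ := by rw [hκ₁def]; linarith

end Summit.CriticalPhenomena.CardyFormulaZ2.Cruxes.MagicFormulaT.LineSketch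

end
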